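import Literature.MathematicalPhysics.QuantumFieldTheory.Balaban1983to89.B6GOneLevelV1Bridge
import Literature.MathematicalPhysics.QuantumFieldTheory.BalabanImbrieJaffe1984to88.BIJ85GaugeFnBound513
import HarnessLib

/-!
# Route `UnitScaleTilt`, crux K1 child «MinimiserStabilityRegPr» (stmt-QuantumFields-19200), registered stub `stub_prop7From14` (V3, skeleton v7
# cc37a1787726) — lane B «regularity of the constrained minimiser from the Euler–Lagrange system + print's `H_k`/`G`, NO line-average chart»:
# **FLAT LANDAU-SLICE ELLIPTIC REGULARITY MODULO MULTIPLIERS** — for a real bond field `A` with print's flat residual Landau condition `R∂*A = 0`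
# and EVERY coarse field `ω`:  `A = G(∂*∂A − Q*ω) + H(QA − Q·G(∂*∂A − Q*ω))`, hence at the d = 3 carrier
# `sup|A| ≤ C_G·sup|∂*∂A − Q*ω| + C_H·(sup|Q_kA| + C_G·sup|∂*∂A − Q*ω|)` with ABSOLUTE constants

Cell `ym3-torus` ∕ fleet seat `ym-ust-19200-p3` (WIDTH-LEVER lane B of V3, director R282, owner ARRIVAL-BRIEF-R282 §1; HUMAN RULING D-0037, YM ladder rung R3).
`--supports stmt-QuantumFields-19200 --as helper`.  WHAT THIS IS NOT: nothing of Bałaban's nonlinear analysis is proved; no gauge is constructed;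
flat background only.  NOT a claim about the mass gap.

WHY.  [Balaban1985Variational] derives the regularity of the constrained minimiser `U_k = e^{iηA}` from its Euler–Lagrange equation in the Landau
gauge: in Sect. F (p. 302, flat operators «taken without any external gauge field configuration») the equation is (157) `A = HB + A₁` with (158)
`A₁ = −G̃(…)`, and the bounds (161)–(165) on `A`, `∇A` follow from the letters of `H` and `G̃ = G − HQG` ((129)–(131)).  Print reaches (157) through
the CHART (47) `A = A′ − HD(A′)` of the constraint manifold (lane A of this stub, ★ym-ust-19200-p1, owns that road).  THIS FILE isolates the LINEAR,
CHART-FREE core: on the slice `R∂*A = 0` the operator (2.19) `Δ_a = ∂*∂ + ∂R∂* + Q*aQ` of [Balaban1984PropagatorsII] reads `Δ_a A = ∂*∂A + Q*aQA`, so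
`A = G(Δ_aA)` splits into the propagator applied to the LINEARISED CURRENT `∂*∂A` and a term in the range of `GQ*`; the latter is a MINIMAL
EXTENSION `H(·)` for print's `H = H₀ = GQ*(QGQ*)⁻¹`, characterised by `QH = 1` and `Δ_a(Hβ) ⊥ ker Q`; and `G` applied to ANY multiplier current
`Q*ω` is again a minimal extension («`Q𝔊 = 0`», `G̃Q* = 0`).  For a critical configuration the Euler–Lagrange system says exactly that the true
current `D*F` IS a multiplier current up to the nonlinear remainders (★ym-ust-19200-p2 lineage: `…Prop8EulerLagrangeIter/Family`, multiplier form),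
so the sup norm of `A` is controlled by those remainders and by the constraint datum `Q_kA` — the shape of (165), uniformly in `k` and in the volume.

WHAT IS PROVED (sorry-free, no definition, standard axioms; V1 letters of `B6SectAOperatorsV1`/`B6SectAVectorModelV1`: `GE = Δ_a⁻¹`, `QE`, `QsE = Q*`,
`RE = R`, `dcE = ∂`, `dcsE = ∂*`, `dsE = ∂*` on vector fields, `EE = (QGQ*)⁻¹`).
* §1 (every nested family `D : Domains P`, lattice factor `c ≠ 0`, weights `w > 0`): `deltaAE_apply_of_slice` (`Δ_aA = ∂*∂A + Q*aQA` on the slice),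
  `eq_GE_add_of_slice`, `eq_GE_of_slice_of_QE_eq_zero` (`QA = 0 ⇒ A = G∂*∂A`); **`eq_H_of_QE_eq_of_orth`** (CHARACTERISATION of the minimal extension:
  for ANY map `H` with `Q(Hβ) = β` and `⟪δ, Δ_a(Hβ)⟫ = 0` for `Qδ = 0`, every `y` with `Qy = β`, `Δ_ay ⊥ ker Q` IS `Hβ`), `H_unique`,
  `QE_GE_QsE_EE`/`orth_GE_QsE_EE` (`GQ*(QGQ*)⁻¹` is such an `H`), **`GE_QsE_eq_H`** (`G(Q*ω) = H(QGQ*ω)`: multiplier currents are invisible),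
  **`sub_GE_eq_H_of_slice`** (`A − G(∂*∂A − Q*ω) = H(QA − QG(∂*∂A − Q*ω))` for EVERY `ω`), `sub_GE_eq_H_of_slice_zero`.
* §2 (one level `twoScale j hj1 ∅`: all `Ω_i = T_η`, constraints = the bonds of `T^{(j)}`): `QE_twoScale_empty_eq_zero_iff` (`QA = 0 ↔ Q_jA = 0`),
  `curlAction_add_smul` (second-order expansion of the abelian action), **`sum_curl_mul_curl_eq_zero_of_minimal`** (curl-minimality over `{Q_jA = b}`
  ⇒ `⟨∂δ, ∂(Hb)⟩ = 0` for `Q_jδ = 0`), **`inner_deltaAE_H_eq_zero`** (`Q_jH = 1` ∧ `R∂*H = 0` ∧ curl-minimal ⇒ `Δ_a`-orthogonality — the three printed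
  properties of `H_k`, [Balaban1984PropagatorsI] p. 29, in the tree for print's `H` as `FlatMinimizerH.bondAvgIter_H_eq`,
  `FlatMinimizerHLandau.RE_dsE_H_eq_zero(_T3)`, `FlatMinimizerHLandau.curlAction_H_le(_T3)`), **`eq_GE_add_H_of_slice`** (the representation with such
  an `H`), **`abs_le_of_slice_of_letters`** (`|A(e)| ≤ C_G·B + C_H·(β + C_G·B)` from the sup letters of `G` and `H`, `sup|∂*∂A − Q*ω| ≤ B`,
  `sup|Q_jA| ≤ β`; `|Q_j·| ≤ sup|·|` is `BIJ85GaugeFnBound513.norm_bondAvgIter_le`).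
* §3 (appended) the CRITICAL-POINT FORM: `exists_QsE_eq_of_orth_ker` (`(ker Q)ᗮ = range Q*`), **`add_GE_eq_H_of_multiplier`** /
  **`add_GE_eq_H_of_critical`** (print's (127) `⟨δ, ∂*∂A + r⟩ = 0` for `Qδ = 0` ⇒ (133) `A + Gr = H(QA + QGr)`, i.e. `A − H(QA) = −G̃r`),
  **`abs_le_of_critical_of_letters`** (`|A| ≤ C_G·sup|r| + C_H·(sup|Q_jA| + C_G·sup|r|)`).
* The d = 3 carrier instance with print's `H` and the flat `G` of [B5] (ABSOLUTE constants, `FlatPropagatorSup.abs_GE_le_sup_T3`, `FlatMinimizerH.abs_H_le`)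
  is the sequel `UnitScaleTiltProp7FlatSliceRegularityT3`.

HONEST SCOPE.  (i) LINEAR and FLAT: `U₀ = 1`, one level (the pure small-field problem of the carrier: every `Ω_i` the whole torus); the covariant
chart [Balaban1985RegularSpaces] Thm 2 about a non-flat background (V3-A) and the background propagators of [Balaban1985BackgroundPropagators] are NOT
touched.  (ii) `Q*` is the `ℓ²`-adjoint `QsE` of the straight `k`-fold block average `bondAvgIter` ([Balaban1984PropagatorsI] (1.18)); the transpose of
the TRUE linearised (0.4)-constraint differs from `L^k·Q*` by a coarse pure gauge (★p2's `Prop7IterLinStructure`: `Q^{(k)} = L^k·Q_k − dΛ_k`) — the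
port is the consumer's.  (iii) The sup letters only (first member of (1.136)/(165)); the gradient and Laplacian letters of `G`/`H` exist
(`FlatPropagatorGradGlobal.exists_GE_sup_grad_lap_T3`, `FlatMinimizerH.abs_grad_H_le`) and give the second member the same way (not written here).
(iv) Constants crude (pub-balaban's), functions of `d` alone.  DEDUP: the matrix-level identities of ★f4's `FlatCriticalEquation143`
(`eq143_of_critical`, `rightInverse_eq_H₀`, `Gt_eq_G_sub_H₀QG`) are the same algebra over abstract `Fin`-indexed matrices UNDER a criticality
hypothesis; here: V1 operators on the Setup torus, no criticality, explicit slice condition `RE (dsE A) = 0`, concrete letters.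

References: T. Bałaban, CMP **102** (1985) 277–309 [Balaban1985Variational] ((21) p.281, (45)–(47) p.285, (129)–(131) p.297, (157)–(158) p.302,
(165) p.303); CMP **96** (1984) 223–250 [Balaban1984PropagatorsII] ((2.12) p.225, (2.19)/(2.22) p.226, (2.35) p.228); CMP **95** (1984) 17–40
[Balaban1984PropagatorsI] (p.29 properties of `H_k`, (1.115) p.36); CMP **99** (1985) 75–102 [Balaban1985RegularSpaces] (Prop. 6, (1.136)–(1.138) p.99).
-/

set_option autoImplicit false

noncomputable section

open scoped BigOperators InnerProductSpace Matrix ComplexConjugate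

namespace Summit.QuantumFields.YangMills.Theorems.Prop7FlatSliceRegularity

open Literature.MathematicalPhysics.QuantumFieldTheory.Balaban1983to89
open Literature.MathematicalPhysics.QuantumFieldTheory.BalabanImbrieJaffe1984to88.BIJ85AxialPropagator411 (BondSpace PlaqSpace
  bondAvgIter_add bondAvgIter_smul)
open Literature.MathematicalPhysics.QuantumFieldTheory.BalabanImbrieJaffe1984to88.BIJ85GaugeFnBound513 (norm_bondAvgIter_le)
open LatticeFieldCalculus B6SectADomainsV1 B6SectAOperatorsV1 B6SectAVectorModelV1 B6SectCTwoScaleV1 B6GOneLevelV1Bridge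

variable {P : Params}

/-! ## §1 The algebra on print's flat Landau slice `R∂*A = 0`, every nested family `D` -/

section General

variable (D : Domains P)

/-- On the slice `R∂*A = 0` the operator (2.19) loses its gauge term: `Δ_a A = ∂*∂A + Q*aQA`.
[cite: Balaban1984PropagatorsII, (2.19) p.226] -/
theorem deltaAE_apply_of_slice (c : ℝ) (w : BondIdx D → ℝ) {x : BondSpace P} (hx : RE D c (dsE c x) = 0) :
    deltaAE D c w x = dcsE c (dcE c x) + QsE D (aE D w (QE D x)) := by
  simp only [deltaAE_def, LinearMap.add_apply, LinearMap.coe_comp, Function.comp_apply, hx, map_zero, add_zero]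

/-- On the slice: `A = G(∂*∂A) + G(Q*aQA)`, `G = Δ_a⁻¹`. [cite: Balaban1984PropagatorsII, (2.22) p.226] -/
theorem eq_GE_add_of_slice {c : ℝ} (hc : c ≠ 0) {w : BondIdx D → ℝ} (hw : ∀ i, 0 < w i) {x : BondSpace P} (hx : RE D c (dsE c x) = 0) :
    x = GE D hc hw (dcsE c (dcE c x)) + GE D hc hw (QsE D (aE D w (QE D x))) := by
  rw [← map_add, ← deltaAE_apply_of_slice D c w hx, GE_deltaAE]

/-- On the slice with vanishing constraints `QA = 0`: `A = G(∂*∂A)` — the field is the propagator applied to its own linearised current.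
[cite: Balaban1984PropagatorsII, (2.22) p.226] -/
theorem eq_GE_of_slice_of_QE_eq_zero {c : ℝ} (hc : c ≠ 0) {w : BondIdx D → ℝ} (hw : ∀ i, 0 < w i) {x : BondSpace P} (hx : RE D c (dsE c x) = 0) (hQ : QE D x = 0) :
    x = GE D hc hw (dcsE c (dcE c x)) := by
  have h := eq_GE_add_of_slice D hc hw hx
  rwa [hQ, map_zero, map_zero, map_zero, add_zero] at h

/-- **CHARACTERISATION OF THE MINIMAL EXTENSION.**  Let `H` be ANY map with `Q(Hβ) = β` and the `Δ_a`-orthogonality `⟪δ, Δ_a(Hβ)⟫ = 0` for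
`Qδ = 0` (print's `H₀ = GQ*(QGQ*)⁻¹` of [Balaban1985Variational] (129), cf. (45)).  Then every `y` with `Qy = β` and `Δ_a y ⊥ ker Q` IS `Hβ`.
[cite: Balaban1985Variational, (129) p.297, (45) p.285] -/
theorem eq_H_of_QE_eq_of_orth {c : ℝ} (hc : c ≠ 0) {w : BondIdx D → ℝ} (hw : ∀ i, 0 < w i) {H : BondIdxSpace D → BondSpace P} (hHQ : ∀ β, QE D (H β) = β)
    (hHorth : ∀ β δ, QE D δ = 0 → ⟪δ, deltaAE D c w (H β)⟫_ℝ = 0)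
    {y : BondSpace P} {β : BondIdxSpace D} (hy : QE D y = β) (horth : ∀ δ, QE D δ = 0 → ⟪δ, deltaAE D c w y⟫_ℝ = 0) :
    y = H β := by
  have hz : QE D (y - H β) = 0 := by rw [map_sub, hy, hHQ, sub_self]
  have h0 : ⟪y - H β, deltaAE D c w (y - H β)⟫_ℝ = 0 := by
    rw [map_sub, inner_sub_right, horth _ hz, hHorth β _ hz, sub_self]
  exact sub_eq_zero.mp (eq_zero_of_inner_deltaAE_self_eq_zero D hc hw h0)

/-- such an `H` is unique. [cite: Balaban1985Variational, (129) p.297] -/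
theorem H_unique {c : ℝ} (hc : c ≠ 0) {w : BondIdx D → ℝ} (hw : ∀ i, 0 < w i) {H H' : BondIdxSpace D → BondSpace P} (hHQ : ∀ β, QE D (H β) = β)
    (hHorth : ∀ β δ, QE D δ = 0 → ⟪δ, deltaAE D c w (H β)⟫_ℝ = 0) (hHQ' : ∀ β, QE D (H' β) = β)
    (hHorth' : ∀ β δ, QE D δ = 0 → ⟪δ, deltaAE D c w (H' β)⟫_ℝ = 0) (β : BondIdxSpace D) :
    H' β = H β :=
  eq_H_of_QE_eq_of_orth D hc hw hHQ hHorth (hHQ' β) (hHorth' β)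

/-- **`GQ*(QGQ*)⁻¹` IS SUCH AN `H`** (V1 letters: `GE ∘ QsE ∘ EE`, `EE = (QGQ*)⁻¹` of [Balaban1984PropagatorsII] p.228): `Q(GQ*Eβ) = β`.
[cite: Balaban1984PropagatorsII, (2.35) p.228] -/
theorem QE_GE_QsE_EE {c : ℝ} (hc : c ≠ 0) {w : BondIdx D → ℝ} (hw : ∀ i, 0 < w i) (β : BondIdxSpace D) : QE D (GE D hc hw (QsE D (EE D hc hw β))) = β := by
  have h := LinearMap.congr_fun (comp_EE D hc hw) β
  simpa [qgqE_def] using h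

/-- and `Δ_a(GQ*Eβ) = Q*Eβ ⊥ ker Q`. [cite: Balaban1984PropagatorsII, (2.22) p.226] -/
theorem orth_GE_QsE_EE {c : ℝ} (hc : c ≠ 0) {w : BondIdx D → ℝ} (hw : ∀ i, 0 < w i) (β : BondIdxSpace D) (δ : BondSpace P) (hδ : QE D δ = 0) :
    ⟪δ, deltaAE D c w (GE D hc hw (QsE D (EE D hc hw β)))⟫_ℝ = 0 := by
  rw [deltaAE_GE, real_inner_comm, inner_QsE_left, hδ, inner_zero_right]

variable {c : ℝ} (hc : c ≠ 0) {w : BondIdx D → ℝ} (hw : ∀ i, 0 < w i)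
  {H : BondIdxSpace D → BondSpace P} (hHQ : ∀ β, QE D (H β) = β)
  (hHorth : ∀ β δ, QE D δ = 0 → ⟪δ, deltaAE D c w (H β)⟫_ℝ = 0)
include hc hw hHQ hHorth

/-- **MULTIPLIER CURRENTS ARE INVISIBLE**: `G(Q*ω) = H(Q G Q*ω)` — the propagator applied to a pure multiplier current `Q*ω` is a minimal
extension, i.e. `G̃Q* = 0` for `G̃ = G − HQG` ([Balaban1985Variational] (129)–(131): «Q𝔊 = 0», `𝔊 = G − GQ*(QGQ*)⁻¹QG`).
[cite: Balaban1985Variational, (129)-(131) p.297] -/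
theorem GE_QsE_eq_H (ω : BondIdxSpace D) : GE D hc hw (QsE D ω) = H (QE D (GE D hc hw (QsE D ω))) :=
  eq_H_of_QE_eq_of_orth D hc hw hHQ hHorth rfl fun δ hδ => by
    rw [deltaAE_GE, real_inner_comm, inner_QsE_left, hδ, inner_zero_right]

/-- **THE REPRESENTATION ON THE SLICE, MODULO MULTIPLIERS**: for every `A` with `R∂*A = 0` and EVERY coarse field `ω`,
`A − G(∂*∂A − Q*ω) = H(QA − Q·G(∂*∂A − Q*ω))`.
So a slice field is its minimal extension `H(·)` of (block-average data) plus the propagator applied to ITS LINEARISED CURRENT MINUS ANY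
MULTIPLIER CURRENT — the linear flat skeleton of [Balaban1985Variational] (157) `A = HB + A₁` with (158)/(165) `A₁ = −G̃(…)`, obtained
here WITHOUT the chart (47) and for an arbitrary slice field (no criticality). [cite: Balaban1985Variational, (157)-(158) p.302, (129) p.297] -/
theorem sub_GE_eq_H_of_slice {x : BondSpace P} (hx : RE D c (dsE c x) = 0) (ω : BondIdxSpace D) :
    x - GE D hc hw (dcsE c (dcE c x) - QsE D ω)
      = H (QE D x - QE D (GE D hc hw (dcsE c (dcE c x) - QsE D ω))) := by
  refine eq_H_of_QE_eq_of_orth D hc hw hHQ hHorth (by rw [map_sub]) fun δ hδ => ?_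
  rw [map_sub, deltaAE_GE, deltaAE_apply_of_slice D c w hx]
  have : dcsE c (dcE c x) + QsE D (aE D w (QE D x)) - (dcsE c (dcE c x) - QsE D ω) = QsE D (aE D w (QE D x) + ω) := by
    rw [map_add]; abel
  rw [this, real_inner_comm, inner_QsE_left, hδ, inner_zero_right]

/-- The case `ω = 0`: `A − G(∂*∂A) = H(QA − QG∂*∂A)`. [cite: Balaban1985Variational, (157)-(158) p.302] -/
theorem sub_GE_eq_H_of_slice_zero {x : BondSpace P} (hx : RE D c (dsE c x) = 0) :
    x - GE D hc hw (dcsE c (dcE c x)) = H (QE D x - QE D (GE D hc hw (dcsE c (dcE c x)))) := by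
  simpa using sub_GE_eq_H_of_slice D hc hw hHQ hHorth hx 0

end General

/-! ## §2 One level (`twoScale j hj1 ∅`): the `Δ_a`-orthogonality of a curl-minimal right inverse, and the representation read with it -/

section OneLevel

variable {j : ℕ} (hj1 : j + 1 ≤ P.m + P.K)

/-- `QA = 0` for the one-level structure (all `Ω_i = T_η`, `Λ′ = ∅`: constraints = the bonds of `T^{(j)}`) iff `Q_jA = 0`.
[cite: Balaban1984PropagatorsII, (2.97) p.240] -/
theorem QE_twoScale_empty_eq_zero_iff (x : BondSpace P) :
    QE (twoScale j hj1 (∅ : Finset (Site P (j + 1)))) x = 0 ↔ bondAvgIter j (WithLp.ofLp x) = 0 := by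
  rw [QE_eq_zero_iff, twoScale.constr_zero_iff]
  constructor
  · rintro ⟨h1, -⟩
    funext b
    exact h1 b (Finset.notMem_empty _) (Finset.notMem_empty _)
  · intro h
    refine ⟨fun b _ _ => by rw [h]; rfl, fun e he => ?_⟩
    rcases he with he | he <;> exact absurd he (Finset.notMem_empty _)

/-- the constraint value at the level-`j` index of a bond `b` is `(Q_jA)(b)`. [cite: Balaban1984PropagatorsII, (2.20) p.226] -/
theorem QE_apply_bondIdxOfEmpty (x : BondSpace P) (b : PBond P j) :
    QE (twoScale j hj1 (∅ : Finset (Site P (j + 1)))) x (bondIdxOfEmpty hj1 b) = bondAvgIter j (WithLp.ofLp x) b := rfl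

/-- `⟨∂δ, ∂y⟩ = Σ_p (∂δ)(p)(∂y)(p)`. [cite: Balaban1984PropagatorsII, (2.5) p.224] -/
theorem inner_dcE_dcE (c : ℝ) (x y : BondSpace P) :
    ⟪dcE c x, dcE c y⟫_ℝ = ∑ p : Plaq P 0, curl c (WithLp.ofLp x) p * curl c (WithLp.ofLp y) p := by
  rw [inner_eq_sum]
  rfl

/-- the abelian action of a real field as a plain sum of squares. [cite: Balaban1984PropagatorsI, (1.3) p.18] -/
theorem curlAction_real_eq (κ c : ℝ) (A : VecField P 0 ℝ) :
    curlAction κ c A = κ / 2 * ∑ p : Plaq P 0, (curl c A p) ^ 2 := by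
  unfold curlAction
  rw [← Finset.mul_sum]
  simp only [Real.norm_eq_abs, sq_abs]
  ring

/-- second-order expansion of the abelian action along a line `A + tδ`. [cite: Balaban1984PropagatorsI, (1.3) p.18] -/
theorem curlAction_add_smul (κ c : ℝ) (A δ : VecField P 0 ℝ) (t : ℝ) :
    curlAction κ c (A + t • δ)
      = curlAction κ c A + t * (κ * ∑ p : Plaq P 0, curl c δ p * curl c A p)
        + t ^ 2 * (κ / 2 * ∑ p : Plaq P 0, (curl c δ p) ^ 2) := by
  rw [curlAction_real_eq, curlAction_real_eq]
  have hlin : ∀ p : Plaq P 0, curl c (A + t • δ) p = curl c A p + t * curl c δ p := fun p => by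
    simp only [curl, Pi.add_apply, Pi.smul_apply, smul_eq_mul]
    ring
  have hsq : ∀ p : Plaq P 0, (curl c A p + t * curl c δ p) ^ 2
      = (curl c A p) ^ 2 + (2 * t * (curl c δ p * curl c A p) + t ^ 2 * (curl c δ p) ^ 2) := fun p => by ring
  simp only [hlin, hsq, Finset.sum_add_distrib, ← Finset.mul_sum]
  ring

/-- a quadratic polynomial in `t` that never drops below its value at `t = 0` has no linear term. [folklore] -/
theorem eq_zero_of_forall_le_add_linear_add_sq {m a b : ℝ} (hb : 0 ≤ b) (h : ∀ t : ℝ, m ≤ m + t * a + t ^ 2 * b) : a = 0 := by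
  have hb1 : (0 : ℝ) < b + 1 := by linarith
  have key : 0 ≤ -(a / (b + 1)) * a + (-(a / (b + 1))) ^ 2 * b := by linarith [h (-(a / (b + 1)))]
  have hrw : -(a / (b + 1)) * a + (-(a / (b + 1))) ^ 2 * b = -(a ^ 2 / (b + 1) ^ 2) := by
    field_simp
    ring
  rw [hrw] at key
  have hsq : a ^ 2 / (b + 1) ^ 2 = 0 := le_antisymm (by linarith) (by positivity)
  rcases div_eq_zero_iff.mp hsq with h0 | h0
  · exact pow_eq_zero_iff two_ne_zero |>.mp h0
  · exact absurd h0 (by positivity)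

/-- **CURL-MINIMALITY OVER THE FIBRE `{Q_jA = b}` ⇒ `⟨∂δ, ∂(Hb)⟩ = 0` FOR `Q_jδ = 0`** (the Euler–Lagrange equation of the LINEAR constrained problem
[Balaban1984PropagatorsI] p. 29 «H_kB is a minimum of ½⟨∂A, ∂A⟩ on the hyperplane {A : Q_kA = B, …}»), for ANY map `H` with `Q_j(Hb) = b` minimising the
abelian action over the fibre. [cite: Balaban1984PropagatorsI, p.29 (properties of H_k), (1.64)-(1.65)] -/
theorem sum_curl_mul_curl_eq_zero_of_minimal {κ : ℝ} (hκ : 0 < κ) (c : ℝ) {H : VecField P j ℝ → VecField P 0 ℝ}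
    (hQH : ∀ b, bondAvgIter j (H b) = b)
    (hmin : ∀ (b : VecField P j ℝ) (A : VecField P 0 ℝ), bondAvgIter j A = b → curlAction κ c (H b) ≤ curlAction κ c A)
    (b : VecField P j ℝ) (δ : VecField P 0 ℝ) (hδ : bondAvgIter j δ = 0) :
    ∑ p : Plaq P 0, curl c δ p * curl c (H b) p = 0 := by
  have hkey : κ * ∑ p : Plaq P 0, curl c δ p * curl c (H b) p = 0 := by
    refine eq_zero_of_forall_le_add_linear_add_sq (m := curlAction κ c (H b))
      (b := κ / 2 * ∑ p : Plaq P 0, (curl c δ p) ^ 2) (by positivity) fun t => ?_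
    have hfib : bondAvgIter j (H b + t • δ) = b := by
      rw [bondAvgIter_add, bondAvgIter_smul, hδ, smul_zero, add_zero, hQH]
    have h := hmin b _ hfib
    rwa [curlAction_add_smul] at h
  exact (mul_eq_zero.mp hkey).resolve_left hκ.ne'

/-- **`Δ_a`-ORTHOGONALITY OF A LANDAU, CURL-MINIMAL RIGHT INVERSE**: if `Q_j(Hb) = b`, `R∂*(Hb) = 0` and `Hb` minimises the abelian action over
`{Q_jA = b}` (the three printed properties of `H_k`, [Balaban1984PropagatorsI] p. 29 — in the tree for print's `H` as `FlatMinimizerH.bondAvgIter_H_eq`,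
`FlatMinimizerHLandau.RE_dsE_H_eq_zero`, `FlatMinimizerHLandau.curlAction_H_le`), then `⟪δ, Δ_a(Hb)⟫ = 0` for every `δ` with `Qδ = 0` — the
hypothesis `hHorth` of §1, so `H` is print's `H₀ = GQ*(QGQ*)⁻¹` ([Balaban1985Variational] (129)). [cite: Balaban1984PropagatorsI, p.29; Balaban1985Variational, (129) p.297] -/
theorem inner_deltaAE_H_eq_zero (c : ℝ) (w : BondIdx (twoScale j hj1 (∅ : Finset (Site P (j + 1)))) → ℝ) {κ : ℝ} (hκ : 0 < κ)
    {H : VecField P j ℝ → VecField P 0 ℝ} (hQH : ∀ b, bondAvgIter j (H b) = b)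
    (hRH : ∀ b, RE (twoScale j hj1 (∅ : Finset (Site P (j + 1)))) c (dsE c (WithLp.toLp 2 (H b))) = 0)
    (hmin : ∀ (b : VecField P j ℝ) (A : VecField P 0 ℝ), bondAvgIter j A = b → curlAction κ c (H b) ≤ curlAction κ c A)
    (b : VecField P j ℝ) (δ : BondSpace P) (hδ : QE (twoScale j hj1 (∅ : Finset (Site P (j + 1)))) δ = 0) :
    ⟪δ, deltaAE (twoScale j hj1 ∅) c w (WithLp.toLp 2 (H b))⟫_ℝ = 0 := by
  rw [inner_deltaAE_right, hRH, inner_zero_right, add_zero, hδ, inner_zero_left, add_zero, inner_dcE_dcE]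
  exact sum_curl_mul_curl_eq_zero_of_minimal hκ c hQH hmin b _ ((QE_twoScale_empty_eq_zero_iff hj1 δ).mp hδ)

/-- `H` read on the constraint index space satisfies `Q∘H = id`. [cite: Balaban1984PropagatorsI, p.29 «Q_kH_kB = B»] -/
theorem QE_toLp_H {H : VecField P j ℝ → VecField P 0 ℝ} (hQH : ∀ b, bondAvgIter j (H b) = b)
    (β : BondIdxSpace (twoScale j hj1 (∅ : Finset (Site P (j + 1))))) :
    QE (twoScale j hj1 (∅ : Finset (Site P (j + 1)))) (WithLp.toLp 2 (H (fun c' => β (bondIdxOfEmpty hj1 c')))) = β := by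
  ext i
  obtain ⟨c', rfl⟩ := (bondIdxOfEmpty_bijective hj1).2 i
  rw [QE_apply_bondIdxOfEmpty, WithLp.ofLp_toLp, hQH]

/-- **THE ONE-LEVEL REPRESENTATION WITH A LANDAU, CURL-MINIMAL RIGHT INVERSE `H`**: for every real bond field `A` with `R∂*A = 0` and every
coarse `ω`, `A = G(∂*∂A − Q*ω) + H(Q_jA − Q_j G(∂*∂A − Q*ω))` (`G = Δ_a⁻¹` of the one-level structure, lattice factor `c`, weights `w`).
[cite: Balaban1985Variational, (157)-(158) p.302, (45) p.285] -/
theorem eq_GE_add_H_of_slice {c : ℝ} (hc : c ≠ 0) {w : BondIdx (twoScale j hj1 (∅ : Finset (Site P (j + 1)))) → ℝ} (hw : ∀ i, 0 < w i)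
    {κ : ℝ} (hκ : 0 < κ) {H : VecField P j ℝ → VecField P 0 ℝ} (hQH : ∀ b, bondAvgIter j (H b) = b)
    (hRH : ∀ b, RE (twoScale j hj1 (∅ : Finset (Site P (j + 1)))) c (dsE c (WithLp.toLp 2 (H b))) = 0)
    (hmin : ∀ (b : VecField P j ℝ) (A : VecField P 0 ℝ), bondAvgIter j A = b → curlAction κ c (H b) ≤ curlAction κ c A)
    (x : BondSpace P) (hx : RE (twoScale j hj1 (∅ : Finset (Site P (j + 1)))) c (dsE c x) = 0)
    (ω : BondIdxSpace (twoScale j hj1 (∅ : Finset (Site P (j + 1))))) :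
    x = GE (twoScale j hj1 ∅) hc hw (dcsE c (dcE c x) - QsE (twoScale j hj1 ∅) ω)
        + WithLp.toLp 2 (H (fun c' => bondAvgIter j (WithLp.ofLp x) c'
            - bondAvgIter j (WithLp.ofLp (GE (twoScale j hj1 ∅) hc hw (dcsE c (dcE c x) - QsE (twoScale j hj1 ∅) ω))) c')) := by
  have h := sub_GE_eq_H_of_slice (twoScale j hj1 ∅) hc hw
    (H := fun β => WithLp.toLp 2 (H (fun c' => β (bondIdxOfEmpty hj1 c'))))
    (QE_toLp_H hj1 hQH) (fun β δ hδ => inner_deltaAE_H_eq_zero hj1 c w hκ hQH hRH hmin _ δ hδ) hx ω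
  rw [sub_eq_iff_eq_add'] at h
  exact h

/-- **SUP-NORM REGULARITY ON THE SLICE, MODULO MULTIPLIERS — LETTER FORM**: if `G` has the sup letter `|Gu| ≤ C_G·sup|u|` and `H` the sup letter
`|Hb| ≤ C_H·sup|b|`, then for `A` with `R∂*A = 0`, EVERY coarse `ω`, `sup|∂*∂A − Q*ω| ≤ B` and `sup|Q_jA| ≤ β`:
`|A(e)| ≤ C_G·B + C_H·(β + C_G·B)` at every bond `e`. [cite: Balaban1985Variational, (165) p.303, (46) p.285; Balaban1984PropagatorsI, (1.115) p.36] -/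
theorem abs_le_of_slice_of_letters {c : ℝ} (hc : c ≠ 0) {w : BondIdx (twoScale j hj1 (∅ : Finset (Site P (j + 1)))) → ℝ}
    (hw : ∀ i, 0 < w i) {κ : ℝ} (hκ : 0 < κ) {H : VecField P j ℝ → VecField P 0 ℝ} (hQH : ∀ b, bondAvgIter j (H b) = b)
    (hRH : ∀ b, RE (twoScale j hj1 (∅ : Finset (Site P (j + 1)))) c (dsE c (WithLp.toLp 2 (H b))) = 0)
    (hmin : ∀ (b : VecField P j ℝ) (A : VecField P 0 ℝ), bondAvgIter j A = b → curlAction κ c (H b) ≤ curlAction κ c A)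
    {CG CH : ℝ}
    (hGsup : ∀ (u : BondSpace P) (B : ℝ), (∀ e, |u e| ≤ B) → ∀ e, |GE (twoScale j hj1 ∅) hc hw u e| ≤ CG * B)
    (hHsup : ∀ (b : VecField P j ℝ) (β : ℝ), (∀ c', |b c'| ≤ β) → ∀ e, |H b e| ≤ CH * β)
    (x : BondSpace P) (hx : RE (twoScale j hj1 (∅ : Finset (Site P (j + 1)))) c (dsE c x) = 0)
    (ω : BondIdxSpace (twoScale j hj1 (∅ : Finset (Site P (j + 1))))) {B β : ℝ}
    (hB : ∀ e, |(dcsE c (dcE c x) - QsE (twoScale j hj1 ∅) ω) e| ≤ B)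
    (hβ : ∀ c', |bondAvgIter j (WithLp.ofLp x) c'| ≤ β) (e : PBond P 0) :
    |x e| ≤ CG * B + CH * (β + CG * B) := by
  have hrep := eq_GE_add_H_of_slice hj1 hc hw hκ hQH hRH hmin x hx ω
  set u := dcsE c (dcE c x) - QsE (twoScale j hj1 ∅) ω with hu
  have hGu : ∀ e, |GE (twoScale j hj1 ∅) hc hw u e| ≤ CG * B := hGsup u B hB
  have hdat : ∀ c', |bondAvgIter j (WithLp.ofLp x) c' - bondAvgIter j (WithLp.ofLp (GE (twoScale j hj1 ∅) hc hw u)) c'| ≤ β + CG * B :=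
    fun c' => (abs_sub _ _).trans (add_le_add (hβ c') (by
      have h := norm_bondAvgIter_le j (WithLp.ofLp (GE (twoScale j hj1 ∅) hc hw u)) (a := CG * B)
        (fun e => by rw [Real.norm_eq_abs]; exact hGu e) c'
      rwa [Real.norm_eq_abs] at h))
  have hxe : x e = GE (twoScale j hj1 ∅) hc hw u e
      + H (fun c' => bondAvgIter j (WithLp.ofLp x) c' - bondAvgIter j (WithLp.ofLp (GE (twoScale j hj1 ∅) hc hw u)) c') e := by
    have := congrArg (fun v : BondSpace P => v e) hrep
    simpa using this
  rw [hxe]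
  exact (abs_add_le _ _).trans (add_le_add (hGu e) (hHsup _ _ hdat e))

end OneLevel

/-! ## §3 The critical-point form: print's (127) `⟨δ, ∂*∂A + r⟩ = 0` for `Qδ = 0` ⇒ (133) `A − H(QA) = −G̃ r`
(appended; lane B, seat ym-ust-19200-p3 g0).  For a critical configuration the Euler–Lagrange equation in the Landau gauge says that the current
`∂*∂A + r` (`r` = everything beyond the flat linear part: the nonlinear Taylor remainders, the background terms, the transposed nonlinear part of
the constraint) is orthogonal to the kernel of the linearised constraint ([Balaban1985Variational] (127)); equivalently it is a multiplier current
`Q*ω` (finite-dimensional Fredholm alternative, `(ker Q)ᗮ = range Q*`).  Then §1–§2 give (133): `A + Gr = H(QA + QGr)`, and the letter form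
`|A| ≤ C_G·sup|r| + C_H·(sup|Q_jA| + C_G·sup|r|)` — the linear flat skeleton of the regularity improvement (133)–(136) of the critical configuration. -/

section Critical

variable (D : Domains P)

/-- **`(ker Q)ᗮ = range Q*`** (finite dimension): a field orthogonal to every `δ` with `Qδ = 0` IS a multiplier current `Q*ω`.
[cite: Balaban1985Variational, (127)-(128) p.297; Balaban1984PropagatorsII, (2.18) p.226] -/
theorem exists_QsE_eq_of_orth_ker {v : BondSpace P} (hv : ∀ δ, QE D δ = 0 → ⟪δ, v⟫_ℝ = 0) : ∃ ω, QsE D ω = v := by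
  have hmem : v ∈ (LinearMap.ker (QE D))ᗮ :=
    (Submodule.mem_orthogonal _ _).mpr fun u hu => hv u (LinearMap.mem_ker.mp hu)
  rw [LinearMap.orthogonal_ker] at hmem
  obtain ⟨ω, hω⟩ := LinearMap.mem_range.mp hmem
  exact ⟨ω, hω⟩

variable {c : ℝ} (hc : c ≠ 0) {w : BondIdx D → ℝ} (hw : ∀ i, 0 < w i)
  {H : BondIdxSpace D → BondSpace P} (hHQ : ∀ β, QE D (H β) = β)
  (hHorth : ∀ β δ, QE D δ = 0 → ⟪δ, deltaAE D c w (H β)⟫_ℝ = 0)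
include hc hw hHQ hHorth

/-- **(133) FROM A MULTIPLIER**: if `R∂*A = 0` and the current `∂*∂A + r` is a multiplier current `Q*ω`, then `A + Gr = H(QA + QGr)`, i.e.
`A − H(QA) = −G̃r` with `G̃ = G − HQG`. [cite: Balaban1985Variational, (133) p.298, (129) p.297] -/
theorem add_GE_eq_H_of_multiplier {x r : BondSpace P} (hx : RE D c (dsE c x) = 0) {ω : BondIdxSpace D}
    (hω : dcsE c (dcE c x) + r = QsE D ω) :
    x + GE D hc hw r = H (QE D x + QE D (GE D hc hw r)) := by
  have h := sub_GE_eq_H_of_slice D hc hw hHQ hHorth hx ω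
  have hr : dcsE c (dcE c x) - QsE D ω = -r := by rw [← hω]; abel
  rw [hr, map_neg, sub_neg_eq_add, map_neg, sub_neg_eq_add] at h
  exact h

/-- **(127) ⇒ (133)**: if `R∂*A = 0` and `⟨δ, ∂*∂A + r⟩ = 0` for every `δ` with `Qδ = 0` (criticality of the constrained functional in the Landau
slice, the nonlinear part collected in `r`), then `A + Gr = H(QA + QGr)`. [cite: Balaban1985Variational, (127) p.297, (133) p.298] -/
theorem add_GE_eq_H_of_critical {x r : BondSpace P} (hx : RE D c (dsE c x) = 0)
    (hcrit : ∀ δ, QE D δ = 0 → ⟪δ, dcsE c (dcE c x) + r⟫_ℝ = 0) :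
    x + GE D hc hw r = H (QE D x + QE D (GE D hc hw r)) := by
  obtain ⟨ω, hω⟩ := exists_QsE_eq_of_orth_ker D hcrit
  exact add_GE_eq_H_of_multiplier D hc hw hHQ hHorth hx hω.symm

end Critical

section CriticalOneLevel

variable {j : ℕ} (hj1 : j + 1 ≤ P.m + P.K)

/-- **THE ONE-LEVEL LETTER FORM OF (133)–(136), LINEAR FLAT SKELETON**: for a Landau, curl-minimal right inverse `H` with sup letter `C_H`, `G` with sup
letter `C_G`, a real bond field `A` with `R∂*A = 0` whose current `∂*∂A + r` is orthogonal to `ker Q` (criticality (127)), `sup|r| ≤ B` and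
`sup|Q_jA| ≤ β`: `|A(e)| ≤ C_G·B + C_H·(β + C_G·B)` — the sup norm of a critical slice field is controlled by the NON-LINEAR REMAINDER of its
current and by its constraint datum only. [cite: Balaban1985Variational, (133)-(136) p.298, (165) p.303] -/
theorem abs_le_of_critical_of_letters {c : ℝ} (hc : c ≠ 0) {w : BondIdx (twoScale j hj1 (∅ : Finset (Site P (j + 1)))) → ℝ}
    (hw : ∀ i, 0 < w i) {κ : ℝ} (hκ : 0 < κ) {H : VecField P j ℝ → VecField P 0 ℝ} (hQH : ∀ b, bondAvgIter j (H b) = b)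
    (hRH : ∀ b, RE (twoScale j hj1 (∅ : Finset (Site P (j + 1)))) c (dsE c (WithLp.toLp 2 (H b))) = 0)
    (hmin : ∀ (b : VecField P j ℝ) (A : VecField P 0 ℝ), bondAvgIter j A = b → curlAction κ c (H b) ≤ curlAction κ c A)
    {CG CH : ℝ}
    (hGsup : ∀ (u : BondSpace P) (B : ℝ), (∀ e, |u e| ≤ B) → ∀ e, |GE (twoScale j hj1 ∅) hc hw u e| ≤ CG * B)
    (hHsup : ∀ (b : VecField P j ℝ) (β : ℝ), (∀ c', |b c'| ≤ β) → ∀ e, |H b e| ≤ CH * β)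
    (x r : BondSpace P) (hx : RE (twoScale j hj1 (∅ : Finset (Site P (j + 1)))) c (dsE c x) = 0)
    (hcrit : ∀ δ, QE (twoScale j hj1 (∅ : Finset (Site P (j + 1)))) δ = 0 → ⟪δ, dcsE c (dcE c x) + r⟫_ℝ = 0)
    {B β : ℝ} (hB : ∀ e, |r e| ≤ B) (hβ : ∀ c', |bondAvgIter j (WithLp.ofLp x) c'| ≤ β) (e : PBond P 0) :
    |x e| ≤ CG * B + CH * (β + CG * B) := by
  obtain ⟨ω, hω⟩ := exists_QsE_eq_of_orth_ker (twoScale j hj1 ∅) hcrit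
  have hr : dcsE c (dcE c x) - QsE (twoScale j hj1 ∅) ω = -r := by rw [hω]; abel
  refine abs_le_of_slice_of_letters hj1 hc hw hκ hQH hRH hmin hGsup hHsup x hx ω (B := B) (fun e' => ?_) hβ e
  rw [hr, PiLp.neg_apply, abs_neg]
  exact hB e'

end CriticalOneLevel

end Summit.QuantumFields.YangMills.Theorems.Prop7FlatSliceRegularity

end
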